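import Mathlib.Analysis.SpecialFunctions.Gamma.Deligne
import Mathlib.Topology.Algebra.InfiniteSum.Basic
import Mathlib.Analysis.SpecialFunctions.Pow.Complex
import Mathlib.Analysis.Meromorphic.Basic
import Mathlib.RingTheory.Ideal.Norm.AbsNorm
import Mathlib.Algebra.Polynomial.BigOperators
import Literature.NumberTheory.GaloisRepresentations.IntegralGaloisAction
import Literature.NumberTheory.GaloisRepresentations.ArtinLFunction
import Literature.NumberTheory.Automorphic.GLnAdelicStructure
import Literature.NumberTheory.Automorphic.GLnCuspidalSpectrum
import HarnessLib

-- D-0014 sorry-sweep (operator, 2026-08-13): sorried theorems -> named facts `def X : Prop`; partial proofs preserved in comments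
-- provenance: harness21/H21/H21/Prelude/AutomorphicAxiomatic/AutomorphicLFunction.lean @ c13436d (interim HEAD d8f2665); M5 mechanical rewrite
/-!
# Standard automorphic L-functions of `GL_n` (trunk G19 AutomorphicAxiomatic, item C16;
notion `automorphic_L_function`)

TRUNKS design 3 (outline D3, §4.3; review F1/F7d/F9): the standard (Godement–Jacquet)
L-function `L(s, Π) = ∏_v L(s, Π_v)` of a cuspidal automorphic representation `Π` of
`GL_n(𝔸_K)`, in two layers.

* **Honest partial L-functions.** A *Satake family* `α : SatakeFamily K` assigns to each finite
  place `v` a multiset `α v` of complex numbers; `eulerPolynomial (α v) = ∏_{a ∈ α v} (1 - a X)`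
  is the inverse local factor and
  `partialStandardL S α s = ∏'_{v ∉ S} eulerPolynomial (α v) (q_v^{-s})⁻¹` (`q_v = v.residueCard`,
  imported from `Literature.Prelude.GalRep.IntegralGaloisAction`) is the partial Euler product away from
  `S`, a `tprod` (genuine value where multipliable, i.e. for Satake data of a unitary cuspidal `Π`
  and `re s > 1` by Jacquet–Shalika; the junk value of `tprod` elsewhere — documented).
  `IsSatakeFamilyOf Π S α` says that `α v` is a Satake parameter of `Π` for every `v ∉ S`
  (`HasSatakeParameterAt` of `GLnAdelicStructure`, honest Hecke eigenvalues, at a principal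
  congruence level `K(𝔫)` with `v ∤ 𝔫` — the accepted refinement of `IsUnramifiedAt`; the
  outline's full-level spelling `glIntegralLevel` would force `Π` unramified everywhere and is
  only provided as the sufficient condition `IsSatakeFamilyOf.of_glIntegralLevel`).
* **The full finite L-function as a hypothesis-structure.** `D : StandardLFunctionData Π` bundles
  a finite set `S` of places at which `Π` is *genuinely ramified* (`not_isUnramifiedAt`), an
  honest Satake family off `S`, and inverse local factors `D.localFactor v : ℂ[X]` of degree `≤ n`
  with constant term `1`, equal to the Satake Euler polynomial off `S`. The L-function
  `D.L s = ∏'_v (D.localFactor v)(q_v^{-s})⁻¹` is *derived* (a `tprod`, exactly like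
  `Literature.NumberTheory.GaloisRepresentations.artinLFunction`); there is no free `L : ℂ → ℂ` field, no gamma/conductor/root-number
  field. Continuation is expressed by the accepted predicates
  `Literature.NumberTheory.GaloisRepresentations.LFunction.HasEntireContinuation` / `HasMeromorphicContinuation` (half-plane `re s > 1`),
  archimedean data by the small structure `ArchimedeanLData d` (a multiset of `d` shifts `μ_j` for
  `∏_j Γ_ℝ(s + μ_j)`, a conductor and a root number), and the functional equation by
  `SatisfiesFunctionalEquation D A D' A'`, verbatim the shape of the accepted
  `Literature.NumberTheory.GaloisRepresentations.ArtinRep.SatisfiesFunctionalEquation` (`∃ Λ Λ'` meromorphic, agreeing with the completed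
  L-functions on `re s > 1`, `Λ (1 - s) = ε Λ' s`).
* **GRH shape.** `IsNonvanishingOnRightHalf L`: every holomorphic `g` on `{re s > 1/2} \ {1}`
  agreeing with `L` on `re s > 1` has no zero with `1/2 < re s < 1` (the domain is connected, so
  `g` is unique by the identity theorem). This is the junk-robust reading of Iwaniec–Kowalski's
  GRH consumed by rh.S04.

## Faithfulness (outline §4.3, in brief)

Junk in `D : StandardLFunctionData Π` is confined to `v ∈ D.S`, where `Π` is ramified; there
`D.localFactor v = P'_v` is a free polynomial of degree `≤ n` with `P'_v(0) = 1`, so on `re s > 1`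
`D.L = L(s, Π) · R(s)` with `R = ∏_{v ∈ S} P_v(q_v^{-s}) / P'_v(q_v^{-s})` (`P_v` the true inverse
factor). By the Jacquet–Shalika / Rudnick–Sarnak *trivial bound* (`L(s, Π_v)` is pole-free on
`re s ≥ 1/2` for every local component of a unitary cuspidal `Π`; Jacquet–Shalika (1981), §1–2;
Rudnick–Sarnak, Duke Math. J. 81 (1996), Appendix) all zeros of `P_v(q_v^{-s})` have
`re s < 1/2`, while poles of `1 / P'_v(q_v^{-s})` on `re s > 1/2` make the hypothesis
"`g` holomorphic on `{re s > 1/2} \ {1}` and `= D.L` on `re s > 1`" of `IsNonvanishingOnRightHalf`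
unsatisfiable for that `D` (Lean's `x⁻¹` junk gives `D.L = 0` there, and no cancellation against
zeros of `L(s, Π)` is available under GRH). Hence `∀ D, IsNonvanishingOnRightHalf D.L` is
equivalent to "no `L(s, Π)` has a zero with `1/2 < re s < 1`", which (functional equation, gamma
factors zero- and pole-free in the strip, class closed under contragredient) is GRH for the
family. "All `D.L` entire ⇒ zeros in the strip on the line" would instead secretly conjoin a
Ramanujan-type statement (zeros of `P_v / P'_v` inside the strip for non-tempered `Π_v`), so it is
*not* used.

## Sources

Godement–Jacquet, *Zeta functions of simple algebras*, LNM 260 (1972); Jacquet, *Principal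
L-functions of the linear group*, Corvallis (1979), Part 2, 63–86; Jacquet–Shalika, *On Euler
products and the classification of automorphic representations I*, Amer. J. Math. 103 (1981);
Iwaniec–Kowalski, *Analytic Number Theory*, §5.1, §5.7; Rudnick–Sarnak (1996).

## Mathlib

Mathlib has `Complex.Gammaℝ`/`Gammaℂ` (`Analysis/SpecialFunctions/Gamma/Deligne.lean`), `tprod`,
`Multipliable`, `Meromorphic`, `Polynomial.eval`, `Multiset.esymm`, and Euler products for
Dirichlet series (`NumberTheory/EulerProduct/`), but no Satake parameters, local Euler
polynomials of automorphic representations or automorphic L-functions (checked by grep: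
`Satake`, `eulerPolynomial`, `automorphic`). All declarations are in `namespace Literature.Automorphic`
(review F2).
-/

noncomputable section

open scoped MatrixGroups
open NumberField IsDedekindDomain MeasureTheory Polynomial Complex

namespace Literature.NumberTheory.Automorphic

/-! ### Satake families and Euler polynomials -/

section Satake

variable (K : Type) [Field K]

/-- A **Satake family** over the number field `K`: an assignment `v ↦ α v` of a multiset of
complex numbers (candidate Satake parameters `{α_{1,v}, …, α_{n,v}}`) to every finite place `v`
of `K` (Borel–Jacquet, Corvallis (1979), §4.6; Iwaniec–Kowalski §5.1, (5.2)).
[cite: BorelJacquetCorvallis1979, §4.6] -/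
abbrev SatakeFamily : Type := HeightOneSpectrum (𝓞 K) → Multiset ℂ

variable {K}

/-- The **Euler polynomial** (inverse local factor) of a multiset `α` of complex numbers:
`∏_{a ∈ α} (1 - a X) ∈ ℂ[X]`, so that `L(s, Π_v) = eulerPolynomial α (q_v^{-s})⁻¹` when `α` is
the Satake parameter of the unramified `Π_v` (Iwaniec–Kowalski §5.1, (5.2); Jacquet, Corvallis
(1979), (1.4)). [folklore] -/
def eulerPolynomial (α : Multiset ℂ) : ℂ[X] :=
  (α.map fun a => 1 - C a * X).prod

/-- The Euler polynomial of the empty multiset is `1`. [folklore] -/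
@[simp]
theorem eulerPolynomial_zero : eulerPolynomial 0 = 1 := by
  simp [eulerPolynomial]

/-- `eulerPolynomial (a ::ₘ α) = (1 - a X) * eulerPolynomial α`. [folklore] -/
@[simp]
theorem eulerPolynomial_cons (a : ℂ) (α : Multiset ℂ) :
    eulerPolynomial (a ::ₘ α) = (1 - C a * X) * eulerPolynomial α := by
  simp [eulerPolynomial]

/-- The Euler polynomial has constant term `1`: `(∏_{a ∈ α} (1 - a X))(0) = 1`
(Iwaniec–Kowalski §5.1). [folklore] -/
@[simp]
theorem eval_zero_eulerPolynomial (α : Multiset ℂ) : (eulerPolynomial α).eval 0 = 1 := by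
  induction α using Multiset.induction_on with
  | empty => simp
  | cons a α ih => simp [ih]

/-- Evaluation of the Euler polynomial: `(eulerPolynomial α)(x) = ∏_{a ∈ α} (1 - a x)`.
[folklore] -/
theorem eval_eulerPolynomial (α : Multiset ℂ) (x : ℂ) :
    (eulerPolynomial α).eval x = (α.map fun a => 1 - a * x).prod := by
  induction α using Multiset.induction_on with
  | empty => simp
  | cons a α ih => simp [ih]

/-- The Euler polynomial has degree at most `card α` (Iwaniec–Kowalski §5.1: the local factor
at an unramified place has degree exactly `n`). [folklore] -/
theorem natDegree_eulerPolynomial_le (α : Multiset ℂ) :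
    (eulerPolynomial α).natDegree ≤ Multiset.card α := by
  induction α using Multiset.induction_on with
  | empty => simp
  | cons a α ih =>
    rw [eulerPolynomial_cons, Multiset.card_cons]
    refine (natDegree_mul_le).trans ?_
    have h1 : (1 - C a * X : ℂ[X]).natDegree ≤ 1 := by
      refine (natDegree_sub_le _ _).trans ?_
      simp only [natDegree_one, zero_le, sup_of_le_right]
      exact (natDegree_C_mul_le a X).trans natDegree_X_le
    omega

/-- The **dual Satake family** `v ↦ {a⁻¹ : a ∈ α v}`: the Satake parameters of the contragredient
`Π̃_v ≅ Π_v^∨` are the inverses of those of `Π_v` (Jacquet, Corvallis (1979), §1;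
Iwaniec–Kowalski §5.1, `L(s, Π̃) = \overline{L(\bar s, Π)}` for unitary `Π`).
[cite: JacquetCorvallis1979, §1] -/
def dualFamily (α : SatakeFamily K) : SatakeFamily K := fun v => (α v).map (·⁻¹)

/-- `dualFamily α v = (α v).map (·⁻¹)` (definitional). [folklore] -/
@[simp]
theorem dualFamily_apply (α : SatakeFamily K) (v : HeightOneSpectrum (𝓞 K)) :
    dualFamily α v = (α v).map (·⁻¹) :=
  rfl

/-- The dual of the dual family is the original family (`(a⁻¹)⁻¹ = a`). [folklore] -/
@[simp]
theorem dualFamily_dualFamily (α : SatakeFamily K) : dualFamily (dualFamily α) = α := by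
  funext v
  simp [dualFamily, Multiset.map_map]

variable [NumberField K]

/-- The **partial standard L-function** of a Satake family away from a set `S` of finite places:
`L^S(s, α) = ∏'_{v ∉ S} ∏_{a ∈ α v} (1 - a q_v^{-s})⁻¹` with `q_v = v.residueCard`, as an
unconditional product (`tprod`) over the subtype `{v // v ∉ S}`. This is the genuine value where
the product is multipliable — for the Satake family of a unitary cuspidal `Π` and `re s > 1`
(`multipliable_partialStandardL`, Jacquet–Shalika) — and the junk value of `tprod` (namely `1`)
elsewhere; continuation is expressed separately via `LFunction.HasMeromorphicContinuation`
(Jacquet–Shalika, Amer. J. Math. 103 (1981), §1, (1.1) and Thm. 5.3; Iwaniec–Kowalski §5.1).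
[folklore] -/
def partialStandardL (S : Set (HeightOneSpectrum (𝓞 K))) (α : SatakeFamily K) (s : ℂ) : ℂ :=
  ∏' v : {v : HeightOneSpectrum (𝓞 K) // v ∉ S},
    ((eulerPolynomial (α v.1)).eval ((v.1.residueCard : ℂ) ^ (-s)))⁻¹

end Satake

/-! ### Satake families of cuspidal representations -/

section Cuspidal

variable {n : ℕ} {K : Type} [Field K] [NumberField K]
  {μ : Measure (AdelicGroupData.gl n K).automorphicQuotient}
  [(AdelicGroupData.gl n K).IsAutomorphicMeasure μ]

/-- `α` **is a Satake family of `Π` away from `S`**: for every finite place `v ∉ S` there are a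
non-zero level `𝔫 ⊆ 𝓞 K` prime to `v` and a uniformizer `ϖ_v` such that `Π` has Satake parameter
`α v` at `v` with respect to the principal congruence subgroup `K(𝔫)` — which is `GL_n(𝒪_v)` at
`v` (`isMaximalAt_principalCongruenceLevel`), so `HasSatakeParameterAt` records the honest
spherical Hecke eigenvalues `q_v^{i(n-i)/2} e_i(α v)` of `T_{v,i}` on a non-zero `K(𝔫)`-fixed
vector (Borel–Jacquet (1979), §4.6; Bump §3.3; Godement–Jacquet, LNM 260, §10). This is exactly
`IsUnramifiedAt Π.1 v` of `GLnAdelicStructure` with the Satake parameter pinned to `α v`; as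
explained there, the outline's spelling with the full level `K^max = glIntegralLevel n K` would
force `Π` to be unramified *everywhere* and make `StandardLFunctionData Π` empty for ramified
`Π`, so we follow the accepted refinement (the outline's version implies ours,
`IsSatakeFamilyOf.of_glIntegralLevel`). [cite: BorelJacquetCorvallis1979, §4.6] -/
def IsSatakeFamilyOf (P : CuspidalAutomorphicRepGL n K μ) (S : Set (HeightOneSpectrum (𝓞 K)))
    (α : SatakeFamily K) : Prop :=
  ∀ v ∉ S, ∃ 𝔫 : Ideal (𝓞 K), 𝔫 ≠ 0 ∧ ¬ v.asIdeal ∣ 𝔫 ∧ ∃ ϖ : (v.adicCompletion K)ˣ,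
    HasSatakeParameterAt P.1 (principalCongruenceLevel n K 𝔫) v ϖ (α v)

/-- The outline's full-level spelling implies `IsSatakeFamilyOf`: Satake parameters at level
`K^max = K(1)` are Satake parameters at the principal congruence level `𝔫 = 𝓞 K`
(`principalCongruenceLevel_top`; Borel–Jacquet (1979), §4.6).
[cite: BorelJacquetCorvallis1979, §4.6] -/
theorem IsSatakeFamilyOf.of_glIntegralLevel {P : CuspidalAutomorphicRepGL n K μ}
    {S : Set (HeightOneSpectrum (𝓞 K))} {α : SatakeFamily K}
    (h : ∀ v ∉ S, ∃ ϖ : (v.adicCompletion K)ˣ,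
      HasSatakeParameterAt P.1 (glIntegralLevel n K) v ϖ (α v)) :
    IsSatakeFamilyOf P S α := by
  intro v hv
  obtain ⟨ϖ, hϖ⟩ := h v hv
  refine ⟨⊤, top_ne_bot, fun hd => v.isPrime.ne_top ?_, ϖ, ?_⟩
  · exact Ideal.eq_top_of_isUnit_mem _ (Ideal.le_of_dvd hd trivial) isUnit_one
  · rwa [principalCongruenceLevel_top]

/-- A Satake family of `Π` away from `S` witnesses that `Π` is unramified at every `v ∉ S`
(definitional). [folklore] -/
theorem IsSatakeFamilyOf.isUnramifiedAt {P : CuspidalAutomorphicRepGL n K μ}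
    {S : Set (HeightOneSpectrum (𝓞 K))} {α : SatakeFamily K} (h : IsSatakeFamilyOf P S α)
    {v : HeightOneSpectrum (𝓞 K)} (hv : v ∉ S) : IsUnramifiedAt P.1 v := by
  obtain ⟨𝔫, h𝔫, hv𝔫, ϖ, hϖ⟩ := h v hv
  exact ⟨𝔫, h𝔫, hv𝔫, ϖ, α v, hϖ⟩

/-- Each member of a Satake family of `Π : GL_n` has `n` entries (definitional, from
`HasSatakeParameterAt.card_eq`). [folklore] -/
theorem IsSatakeFamilyOf.card_eq {P : CuspidalAutomorphicRepGL n K μ}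
    {S : Set (HeightOneSpectrum (𝓞 K))} {α : SatakeFamily K} (h : IsSatakeFamilyOf P S α)
    {v : HeightOneSpectrum (𝓞 K)} (hv : v ∉ S) : Multiset.card (α v) = n := by
  obtain ⟨_, _, _, ϖ, hϖ⟩ := h v hv
  exact hϖ.card_eq

/-- A Satake family away from `S` is a Satake family away from any larger `T ⊇ S`. [folklore] -/
theorem IsSatakeFamilyOf.mono {P : CuspidalAutomorphicRepGL n K μ}
    {S T : Set (HeightOneSpectrum (𝓞 K))} {α : SatakeFamily K} (h : IsSatakeFamilyOf P S α)
    (hST : S ⊆ T) : IsSatakeFamilyOf P T α :=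
  fun v hv => h v fun hvS => hv (hST hvS)

/-- **Non-vacuity.** Every cuspidal `Π` admits a Satake family away from some *finite* set of
places, namely the set of its ramified places (from `eventually_cofinite_isUnramifiedAt` of
`GLnCuspidalSpectrum`, i.e. Flath (1979), Thm. 3 / Borel–Jacquet (1979), §4.6, plus choice);
derived from that named fact in `exists_isSatakeFamilyOf_of_eventually_cofinite` below.
[cite: BorelJacquetCorvallis1979, §4.6] -/
def exists_isSatakeFamilyOf : Prop :=
  ∀ (P : CuspidalAutomorphicRepGL n K μ),
    ∃ (S : Finset (HeightOneSpectrum (𝓞 K))) (α : SatakeFamily K),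
      (∀ v ∈ S, ¬ IsUnramifiedAt P.1 v) ∧ IsSatakeFamilyOf P ↑S α

/- interim proof relied on results that are now named facts (D-0014); demoted to a fact by the D-0014 sorry-sweep, proof preserved:
:= by
  classical
  have hfin : {v : HeightOneSpectrum (𝓞 K) | ¬ IsUnramifiedAt P.1 v}.Finite :=
    eventually_cofinite_isUnramifiedAt P
  refine ⟨hfin.toFinset, fun v => if h : IsUnramifiedAt P.1 v then
    (Classical.choose_spec (Classical.choose_spec h).2.2).choose else 0, ?_, ?_⟩
  · intro v hv
    simpa using hv
  · intro v hv
    have h : IsUnramifiedAt P.1 v := by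
      by_contra h'
      exact hv (by simpa using h')
    refine ⟨Classical.choose h, (Classical.choose_spec h).1, (Classical.choose_spec h).2.1,
      Classical.choose (Classical.choose_spec h).2.2, ?_⟩
    simp only [dif_pos h]
    exact (Classical.choose_spec (Classical.choose_spec h).2.2).choose_spec
-/

/-- `exists_isSatakeFamilyOf` follows from the named fact `eventually_cofinite_isUnramifiedAt`
(Flath (1979), Thm. 3; Borel–Jacquet (1979), §4.6) by choice: take `S` the finite set of ramified
places and pick a Satake parameter at each unramified place (the interim proof, threaded).
[folklore] -/
theorem exists_isSatakeFamilyOf_of_eventually_cofinite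
    (h : eventually_cofinite_isUnramifiedAt (μ := μ)) : exists_isSatakeFamilyOf (μ := μ) := by
  classical
  intro P
  have hfin : {v : HeightOneSpectrum (𝓞 K) | ¬ IsUnramifiedAt P.1 v}.Finite := h P
  refine ⟨hfin.toFinset, fun v => if h : IsUnramifiedAt P.1 v then
    (Classical.choose_spec (Classical.choose_spec h).2.2).choose else 0, ?_, ?_⟩
  · intro v hv
    simpa using hv
  · intro v hv
    have h : IsUnramifiedAt P.1 v := by
      by_contra h'
      exact hv (by simpa using h')
    refine ⟨Classical.choose h, (Classical.choose_spec h).1, (Classical.choose_spec h).2.1,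
      Classical.choose (Classical.choose_spec h).2.2, ?_⟩
    simp only [dif_pos h]
    exact (Classical.choose_spec (Classical.choose_spec h).2.2).choose_spec

/-- **Jacquet–Shalika: absolute convergence of the standard Euler product.** For the Satake
family `α` of a (unitary) cuspidal automorphic representation `Π` of `GL_n(𝔸_K)` away from `S`,
the partial Euler product `∏_{v ∉ S} ∏_{a ∈ α v} (1 - a q_v^{-s})⁻¹` converges (absolutely,
hence unconditionally) for `re s > 1` (Jacquet–Shalika, Amer. J. Math. 103 (1981), Thm. 5.3 with
Remark 5.4, resting on the bound `|α_{j,v}| < q_v^{1/2}` of Cor. 2.5, Remark 2.6 (3) and (5.1.3),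
pp. 515, 554; Iwaniec–Kowalski §5.7). Cuspidal representations in
`L²(GL_n(K) A_G \ GL_n(𝔸_K))` are unitary (outline D10). Reductions and the architecture of the
printed proof: `Literature.NumberTheory.Automorphic.AutomorphicLFunctionProofs`.
[cite: JacquetShalikaAJM1981, Thm. 5.3] -/
def multipliable_partialStandardL : Prop :=
  ∀ (P : CuspidalAutomorphicRepGL n K μ) {S : Set (HeightOneSpectrum (𝓞 K))} {α : SatakeFamily K}
    (_hα : IsSatakeFamilyOf P S α) {s : ℂ} (_hs : 1 < s.re),
    Multipliable fun v : {v : HeightOneSpectrum (𝓞 K) // v ∉ S} =>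
      ((eulerPolynomial (α v.1)).eval ((v.1.residueCard : ℂ) ^ (-s)))⁻¹

end Cuspidal

/-! ### The full finite L-function (hypothesis-structure) -/

section Data

variable {n : ℕ} {K : Type} [Field K] [NumberField K]
  {μ : Measure (AdelicGroupData.gl n K).automorphicQuotient}
  [(AdelicGroupData.gl n K).IsAutomorphicMeasure μ]

/-- **Standard L-function data** for a cuspidal automorphic representation `Π` of `GL_n(𝔸_K)`
(hypothesis-structure, outline D3 / §4.1): a finite set `S` of finite places at each of which `Π`
is *genuinely ramified* (`not_isUnramifiedAt`: no `K_f^max`-spherical Hecke eigenvector), an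
honest Satake family `α` of `Π` away from `S` (`isSatakeFamily`), and inverse local factors
`localFactor v = P_v ∈ ℂ[X]` at *all* finite places, which off `S` are the Satake Euler
polynomials `∏_{a ∈ α v} (1 - a X)` and everywhere have constant term `1` and degree `≤ n`
(as the true Godement–Jacquet factors `L(s, Π_v) = P_v(q_v^{-s})⁻¹` do: Godement–Jacquet, LNM 260,
Thm. 3.3 and §11; Jacquet, Corvallis (1979), (1.3), Thm. (6.5)). There is deliberately no
`L`, gamma, conductor or root-number field: `D.L` is derived, and any junk is confined to the
factors at the ramified places `v ∈ S` (module docstring, §Faithfulness). For `Π` unramified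
everywhere the datum with `S = ∅` is canonical (`StandardLFunctionData.ofUnramified`).
[cite: JacquetCorvallis1979, Thm. (6.5)] -/
structure StandardLFunctionData (P : CuspidalAutomorphicRepGL n K μ) where
  /-- The finite set of (genuinely ramified) exceptional finite places. -/
  S : Finset (HeightOneSpectrum (𝓞 K))
  /-- The Satake family of `Π` (meaningful off `S`). -/
  α : SatakeFamily K
  /-- `α v` is a Satake parameter of `Π` (at a level `K(𝔫)`, `v ∤ 𝔫`) for every `v ∉ S`. -/
  isSatakeFamily : IsSatakeFamilyOf P ↑S α
  /-- Every `v ∈ S` is a genuinely ramified place of `Π`. -/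
  not_isUnramifiedAt : ∀ v ∈ S, ¬ IsUnramifiedAt P.1 v
  /-- The inverse local Euler factors `P_v ∈ ℂ[X]`, `L(s, Π_v) = P_v(q_v^{-s})⁻¹`. -/
  localFactor : HeightOneSpectrum (𝓞 K) → ℂ[X]
  /-- Off `S` the local factor is the Satake Euler polynomial. -/
  localFactor_of_not_mem : ∀ v ∉ S, localFactor v = eulerPolynomial (α v)
  /-- Every local factor has constant term `1`. -/
  eval_zero_localFactor : ∀ v, (localFactor v).eval 0 = 1
  /-- Every local factor has degree at most `n`. -/
  natDegree_localFactor_le : ∀ v, (localFactor v).natDegree ≤ n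

namespace StandardLFunctionData

variable {P : CuspidalAutomorphicRepGL n K μ}

/-- `Π` is unramified at every place outside `D.S`. [folklore] -/
theorem isUnramifiedAt_of_not_mem (D : StandardLFunctionData P) {v : HeightOneSpectrum (𝓞 K)}
    (hv : v ∉ D.S) : IsUnramifiedAt P.1 v :=
  D.isSatakeFamily.isUnramifiedAt (by simpa using hv)

/-- `D.S` is exactly the set of ramified places of `Π` (from `isSatakeFamily` and
`not_isUnramifiedAt`); in particular it does not depend on `D`. [folklore] -/
theorem mem_S_iff (D : StandardLFunctionData P) {v : HeightOneSpectrum (𝓞 K)} :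
    v ∈ D.S ↔ ¬ IsUnramifiedAt P.1 v :=
  ⟨D.not_isUnramifiedAt v, fun h => by_contra fun hv => h (D.isUnramifiedAt_of_not_mem hv)⟩

/-- Two L-function data for the same `Π` have the same exceptional set. [folklore] -/
theorem S_eq (D D' : StandardLFunctionData P) : D.S = D'.S := by
  ext v
  rw [D.mem_S_iff, D'.mem_S_iff]

/-- The **standard L-function** `L(s, Π) = ∏_v P_v(q_v^{-s})⁻¹` attached to the datum `D`, as an
unconditional product (`tprod`) over all finite places of the inverted local factors, exactly
like `Literature.NumberTheory.GaloisRepresentations.artinLFunction`. Genuine value for `re s > 1` (`multipliable_L`), junk value of `tprod`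
elsewhere; continuation via `LFunction.HasEntireContinuation` / `HasMeromorphicContinuation`
(Godement–Jacquet, LNM 260, §11–13; Jacquet, Corvallis (1979), §6; Iwaniec–Kowalski §5.1,
(5.1)–(5.3)). [cite: JacquetCorvallis1979, §6] -/
def L (D : StandardLFunctionData P) (s : ℂ) : ℂ :=
  ∏' v : HeightOneSpectrum (𝓞 K), ((D.localFactor v).eval ((v.residueCard : ℂ) ^ (-s)))⁻¹

/-- **Absolute convergence of `L(s, Π)` for `re s > 1`** (Jacquet–Shalika, Amer. J. Math. 103
(1981), Thm. 5.3; Iwaniec–Kowalski §5.7): the full Euler product of `D` is multipliable on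
`re s > 1` (the finitely many factors at `v ∈ S` do not affect multipliability).
[cite: JacquetShalikaAJM1981, Thm. 5.3] -/
def multipliable_L : Prop :=
  ∀ (D : StandardLFunctionData P) {s : ℂ} (_hs : 1 < s.re),
    Multipliable fun v : HeightOneSpectrum (𝓞 K) =>
      ((D.localFactor v).eval ((v.residueCard : ℂ) ^ (-s)))⁻¹

/-- For `re s > 1`, `L(s, Π) = (∏_{v ∈ S} P_v(q_v^{-s})⁻¹) · L^S(s, Π)`: the full L-function is
the finite product of the exceptional factors times the honest partial standard L-function of
the Satake family (Jacquet–Shalika (1981), §1; splitting a multipliable `tprod` over `ℂ` into a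
finite product and the complementary `tprod`). [cite: JacquetShalikaAJM1981, §1] -/
def L_eq_partialStandardL_mul : Prop :=
  ∀ (D : StandardLFunctionData P) {s : ℂ} (_hs : 1 < s.re),
    D.L s = (∏ v ∈ D.S, ((D.localFactor v).eval ((v.residueCard : ℂ) ^ (-s)))⁻¹) *
      partialStandardL ↑D.S D.α s

variable (P) in
/-- The canonical datum of an **everywhere unramified** `Π` with Satake family `α`: `S = ∅` and
all local factors are Satake Euler polynomials (sorry-free instance of the hypothesis-structure,
outline §4.1; degree bound from `natDegree_eulerPolynomial_le` and `card (α v) = n`). [folklore] -/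
def ofUnramified (α : SatakeFamily K) (hα : IsSatakeFamilyOf P ∅ α) :
    StandardLFunctionData P where
  S := ∅
  α := α
  isSatakeFamily := by simpa using hα
  not_isUnramifiedAt := by simp
  localFactor v := eulerPolynomial (α v)
  localFactor_of_not_mem _ _ := rfl
  eval_zero_localFactor v := eval_zero_eulerPolynomial (α v)
  natDegree_localFactor_le v :=
    (natDegree_eulerPolynomial_le (α v)).trans (hα.card_eq (Set.notMem_empty v)).le

/-- **Non-vacuity of the hypothesis-structure.** Every cuspidal `Π` carries *some*
`StandardLFunctionData` (with `S` its finite set of ramified places, `exists_isSatakeFamilyOf`,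
and the junk local factor `1` at `v ∈ S` — precisely the kind of junk the faithfulness analysis of
the module docstring accounts for; the *true* ramified Godement–Jacquet factors are not
constructed here). The mathematical input is Flath (1979), Thm. 3 / Borel–Jacquet (1979), §4.6
(almost-everywhere unramifiedness); derived from `exists_isSatakeFamilyOf` in
`nonempty_of_exists_isSatakeFamilyOf` below. [cite: BorelJacquetCorvallis1979, §4.6] -/
def nonempty : Prop :=
  ∀ (P : CuspidalAutomorphicRepGL n K μ),
    Nonempty (StandardLFunctionData P)

/- interim proof relied on results that are now named facts (D-0014); demoted to a fact by the D-0014 sorry-sweep, proof preserved: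
:= by
  classical
  obtain ⟨S, α, hS, hα⟩ := exists_isSatakeFamilyOf P
  refine ⟨⟨S, α, hα, hS, fun v => if v ∈ S then 1 else eulerPolynomial (α v),
    fun v hv => if_neg hv, fun v => ?_, fun v => ?_⟩⟩
  · split_ifs <;> simp
  · split_ifs with hv
    · simp
    · exact (natDegree_eulerPolynomial_le (α v)).trans (hα.card_eq (by simpa using hv)).le
-/

/-- `StandardLFunctionData.nonempty` follows from `exists_isSatakeFamilyOf` (Flath (1979), Thm. 3;
Borel–Jacquet (1979), §4.6): take `S` the ramified places, the chosen Satake family, and the junk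
local factor `1` at `v ∈ S` (the interim proof, threaded). [folklore] -/
theorem nonempty_of_exists_isSatakeFamilyOf (h : exists_isSatakeFamilyOf (μ := μ)) :
    nonempty (μ := μ) := by
  classical
  intro P
  obtain ⟨S, α, hS, hα⟩ := h P
  refine ⟨⟨S, α, hα, hS, fun v => if v ∈ S then 1 else eulerPolynomial (α v),
    fun v hv => if_neg hv, fun v => ?_, fun v => ?_⟩⟩
  · split_ifs <;> simp
  · split_ifs with hv
    · simp
    · exact (natDegree_eulerPolynomial_le (α v)).trans (hα.card_eq (by simpa using hv)).le

/-- Hence `StandardLFunctionData.nonempty` follows from the single named fact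
`eventually_cofinite_isUnramifiedAt` of `GLnCuspidalSpectrum`. [folklore] -/
theorem nonempty_of_eventually_cofinite (h : eventually_cofinite_isUnramifiedAt (μ := μ)) :
    nonempty (μ := μ) :=
  nonempty_of_exists_isSatakeFamilyOf (exists_isSatakeFamilyOf_of_eventually_cofinite h)

/-- The L-function of the unramified datum is the partial standard L-function with `S = ∅`
transported along `{v // v ∉ ∅} ≃ HeightOneSpectrum (𝓞 K)` (`tprod` over a subtype of a
predicate that always holds). [folklore] -/
theorem ofUnramified_L (α : SatakeFamily K) (hα : IsSatakeFamilyOf P ∅ α) (s : ℂ) :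
    (ofUnramified P α hα).L s = partialStandardL ∅ α s := by
  simp only [L, ofUnramified, partialStandardL]
  exact (tprod_subtype_eq_of_mulSupport_subset (s := {v | v ∉ (∅ : Set _)}) (by simp)).symm

end StandardLFunctionData

end Data

/-! ### Archimedean data, completed L-function, functional equation -/

/-- **Archimedean L-data of degree `d`** (hypothesis-structure for the gamma factor, conductor
and root number of a standard L-function of degree `d = n · [K : ℚ]` over `ℚ`;
Iwaniec–Kowalski §5.1, (5.3)–(5.5)): a multiset `shifts` of `d` complex numbers `μ_j` giving the
gamma factor `γ(s) = ∏_j Γ_ℝ(s + μ_j)`, a positive integer conductor `N`, and a root number `ε`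
of absolute value `1`. A single multiset of `Γ_ℝ`-shifts suffices also at complex places since
`Γ_ℂ(s) = Γ_ℝ(s) Γ_ℝ(s + 1)` (Legendre duplication; Mathlib `Complex.Gammaℝ_mul_Gammaℝ_add_one`),
so `Γ_ℂ(s + μ) = Γ_ℝ(s + μ) Γ_ℝ(s + μ + 1)` contributes the two shifts `μ, μ + 1`. [folklore] -/
structure ArchimedeanLData (d : ℕ) where
  /-- The archimedean parameters `μ_1, …, μ_d` (shifts of `Γ_ℝ`). -/
  shifts : Multiset ℂ
  /-- There are exactly `d` shifts. -/
  card_shifts : Multiset.card shifts = d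
  /-- The (arithmetic) conductor `N ≥ 1`. -/
  conductor : ℕ
  /-- The conductor is positive. -/
  conductor_pos : 0 < conductor
  /-- The root number `ε`. -/
  rootNumber : ℂ
  /-- The root number has absolute value `1`. -/
  norm_rootNumber : ‖rootNumber‖ = 1

namespace ArchimedeanLData

variable {d : ℕ}

/-- The **gamma factor** `γ(s) = ∏_j Γ_ℝ(s + μ_j)` of archimedean L-data (Mathlib
`Complex.Gammaℝ s = π^{-s/2} Γ(s/2)`; Iwaniec–Kowalski §5.1, (5.3)). [folklore] -/
def gammaFactor (A : ArchimedeanLData d) (s : ℂ) : ℂ :=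
  (A.shifts.map fun m => Complex.Gammaℝ (s + m)).prod

/-- The conductor of archimedean L-data is non-zero (as a complex number). [folklore] -/
theorem conductor_ne_zero (A : ArchimedeanLData d) : (A.conductor : ℂ) ≠ 0 :=
  Nat.cast_ne_zero.mpr A.conductor_pos.ne'

/-- The root number is non-zero. [folklore] -/
theorem rootNumber_ne_zero (A : ArchimedeanLData d) : A.rootNumber ≠ 0 := by
  rw [← norm_ne_zero_iff, A.norm_rootNumber]
  exact one_ne_zero

end ArchimedeanLData

section Completed

variable {n : ℕ} {K : Type} [Field K] [NumberField K]
  {μ : Measure (AdelicGroupData.gl n K).automorphicQuotient}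
  [(AdelicGroupData.gl n K).IsAutomorphicMeasure μ]

/-- The **completed standard L-function** `Λ(s, Π) = N^{s/2} γ(s) L(s, Π)` of the finite datum
`D` and archimedean datum `A` of degree `n · [K : ℚ]` (the degree over `ℚ` of the standard
L-function of `GL_n` over `K`); genuine value for `re s > 1`, cf. `StandardLFunctionData.L`
(Iwaniec–Kowalski §5.1, (5.4); Godement–Jacquet, LNM 260, Thm. 13.8; shape of
`Literature.NumberTheory.GaloisRepresentations.completedArtinLFunction`). [folklore] -/
def completedL {P : CuspidalAutomorphicRepGL n K μ} (D : StandardLFunctionData P)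
    (A : ArchimedeanLData (n * Module.finrank ℚ K)) (s : ℂ) : ℂ :=
  (A.conductor : ℂ) ^ (s / 2) * A.gammaFactor s * D.L s

/-- `(D, A)` and `(D', A')` **satisfy the functional equation** (with `(D', A')` in the role of the
data of the contragredient `Π̃`): there are meromorphic functions `Λ`, `Λ'` on `ℂ` continuing the
completed L-functions `completedL D A`, `completedL D' A'` from `re s > 1`, such that
`Λ(1 - s) = ε · Λ'(s)` for all `s`, with `ε = A.rootNumber`. Verbatim the shape of the accepted
`Literature.NumberTheory.GaloisRepresentations.ArtinRep.SatisfiesFunctionalEquation` (the root number is now carried by `A`)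
(Godement–Jacquet, LNM 260, Thm. 13.8; Jacquet, Corvallis (1979), Thm. (6.2);
Iwaniec–Kowalski §5.1, (5.5)). [cite: JacquetCorvallis1979, Thm. (6.2)] -/
def SatisfiesFunctionalEquation {P P' : CuspidalAutomorphicRepGL n K μ}
    (D : StandardLFunctionData P) (A : ArchimedeanLData (n * Module.finrank ℚ K))
    (D' : StandardLFunctionData P') (A' : ArchimedeanLData (n * Module.finrank ℚ K)) : Prop :=
  ∃ Λ Λ' : ℂ → ℂ, Meromorphic Λ ∧ Meromorphic Λ' ∧
    (∀ s : ℂ, 1 < s.re → Λ s = completedL D A s ∧ Λ' s = completedL D' A' s) ∧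
    ∀ s : ℂ, Λ (1 - s) = A.rootNumber * Λ' s

/-- The functional equation predicate yields meromorphic continuation of `Λ(s, Π)`
(projection of the first witness; as `Literature.ArtinRep.SatisfiesFunctionalEquation.
hasMeromorphicContinuation`). Godement–Jacquet, LNM 260, Thm. 13.8. [folklore] -/
theorem SatisfiesFunctionalEquation.hasMeromorphicContinuation
    {P P' : CuspidalAutomorphicRepGL n K μ} {D : StandardLFunctionData P}
    {A : ArchimedeanLData (n * Module.finrank ℚ K)} {D' : StandardLFunctionData P'}
    {A' : ArchimedeanLData (n * Module.finrank ℚ K)} (h : SatisfiesFunctionalEquation D A D' A') :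
    GaloisRepresentations.LFunction.HasMeromorphicContinuation (completedL D A) := by
  obtain ⟨Λ, _, hΛ, _, hagree, _⟩ := h
  exact ⟨Λ, hΛ, fun s hs => (hagree s hs).1⟩

/-- The functional equation predicate also yields meromorphic continuation of `Λ(s, Π̃)`
(projection of the second witness). Godement–Jacquet, LNM 260, Thm. 13.8. [folklore] -/
theorem SatisfiesFunctionalEquation.hasMeromorphicContinuation_right
    {P P' : CuspidalAutomorphicRepGL n K μ} {D : StandardLFunctionData P}
    {A : ArchimedeanLData (n * Module.finrank ℚ K)} {D' : StandardLFunctionData P'}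
    {A' : ArchimedeanLData (n * Module.finrank ℚ K)} (h : SatisfiesFunctionalEquation D A D' A') :
    GaloisRepresentations.LFunction.HasMeromorphicContinuation (completedL D' A') := by
  obtain ⟨_, Λ', _, hΛ', hagree, _⟩ := h
  exact ⟨Λ', hΛ', fun s hs => (hagree s hs).2⟩

end Completed

/-! ### The GRH shape -/

/-- `L` **is non-vanishing on the right half of the critical strip** (junk-robust GRH shape,
outline D3 / §4.3): every function `g` holomorphic on the connected open set
`{s | 1/2 < re s} \ {1}` which agrees with `L` on `re s > 1` satisfies `g s ≠ 0` whenever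
`1/2 < re s < 1`. Since the domain is connected and contains the half-plane `re s > 1`, such a
`g` is unique (identity theorem), so this says: *the* holomorphic continuation of `L` to
`{re s > 1/2} \ {1}`, if it exists, has no zeros in `1/2 < re s < 1` (vacuous if `L` has no such
continuation, e.g. a pole in the open right half-strip). For the standard L-function of a
cuspidal `Π` of `GL_n` (class closed under `Π ↦ Π̃`, functional equation `s ↦ 1 - s`) this is
equivalent to Iwaniec–Kowalski's Grand Riemann Hypothesis "all zeros of `Λ(s, Π)` have
`re s = 1/2`" (Iwaniec–Kowalski, *Analytic Number Theory*, §5.7; cf. Mathlib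
`RiemannHypothesis`). [folklore] -/
def IsNonvanishingOnRightHalf (L : ℂ → ℂ) : Prop :=
  ∀ g : ℂ → ℂ, DifferentiableOn ℂ g ({s : ℂ | 1 / 2 < s.re} \ {1}) →
    (∀ s : ℂ, 1 < s.re → g s = L s) → ∀ s : ℂ, 1 / 2 < s.re → s.re < 1 → g s ≠ 0

/-- `IsNonvanishingOnRightHalf L` depends only on the values of `L` on `re s > 1`. [folklore] -/
theorem isNonvanishingOnRightHalf_congr {L L' : ℂ → ℂ} (h : ∀ s : ℂ, 1 < s.re → L s = L' s) :
    IsNonvanishingOnRightHalf L ↔ IsNonvanishingOnRightHalf L' := by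
  refine ⟨fun H g hg hgL => H g hg fun s hs => ?_, fun H g hg hgL => H g hg fun s hs => ?_⟩
  · rw [hgL s hs, h s hs]
  · rw [hgL s hs, ← h s hs]

end Literature.NumberTheory.Automorphic
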